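import Mathlib
import Summits.KontsevichZagierPeriods.KontsevichZagierPeriods.Theorems.SoloInformedKummerTorsionFourCircKernel
import HarnessLib
import HarnessLib.Audit

/-!
# The negative order-four torsion packet: the `ℚ(s)`-identities (kernel of COR XXIX.10, negative)

Along the same modulus `M(s) = ((s²−1)/(2s))⁴` (`1 < s`, `s² < 2s+1`) the NEGATIVE order-four
packet has parameter `n(s) = −(s−1)³(s+1)/(4s³) < 0` (torsion parameter `a = iK′/4`) and the
quarter-turn Pell–Abel unit `h = (1 + ct²)√Δ + i·t(g₁ + g₃t²)` with `c = −(s−1)⁴/(4s⁴)`,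
`g₁ = (s²−2s+3)(s²+2s−1)/(4s²)`, `g₃ = −(s−1)⁴(s²+2s−1)(3s²+2s+1)/(16s⁶)`: `|h|² = (1−nt²)⁴`,
`2(CB′−C′B)Δ − CBΔ′ = (q₀ + q₂t²)(1−nt²)³` with `q₀ = (s²−2s+3)(s²+2s−1)/(2s²)`,
`q₂ = −(s−1)³(s+1)(s²+2s−1)(3s²+2s+1)/(8s⁵)`, whence `α = (3s²+2s+1)/(4(s²+1))`,
`β = s²/(2(s²+1)(s²+2s−1))` and (THEOREM XXXI′) `Π(n(s) | M(s)) = αK + βπ`; fibre `s = 2`: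
`Π(−3/32 | 81/256) = 17K/20 + 2π/35`.  Pure algebra.
-/

noncomputable section

open Set

open Literature.NumberTheory.Transcendental Literature.NumberTheory.Transcendental.KZ
open Literature.ModelTheory.ExponentialFields

namespace Summit.KontsevichZagierPeriods.KontsevichZagierPeriods.Theorems

/-- The negative parameter `n(s) = −(s−1)³(s+1)/(4s³)`. [this work] -/
def soloInformedN4n (s : ℝ) : ℝ := -((s - 1) ^ 3 * (s + 1)) / (4 * s ^ 3)

/-- `c(s)`: `C = 1 + ct²`. [this work] -/
def soloInformedN4c (s : ℝ) : ℝ := -(s - 1) ^ 4 / (4 * s ^ 4)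

/-- `g₁(s)`: `B = t(g₁ + g₃t²)`. [this work] -/
def soloInformedN4g₁ (s : ℝ) : ℝ := (s ^ 2 - 2 * s + 3) * (s ^ 2 + 2 * s - 1) / (4 * s ^ 2)

/-- `g₃(s)`: `B = t(g₁ + g₃t²)`. [this work] -/
def soloInformedN4g₃ (s : ℝ) : ℝ :=
  -((s - 1) ^ 4 * (s ^ 2 + 2 * s - 1) * (3 * s ^ 2 + 2 * s + 1)) / (16 * s ^ 6)

/-- `q₀(s)`. [this work] -/
def soloInformedN4q₀ (s : ℝ) : ℝ := (s ^ 2 - 2 * s + 3) * (s ^ 2 + 2 * s - 1) / (2 * s ^ 2)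

/-- `q₂(s)`. [this work] -/
def soloInformedN4q₂ (s : ℝ) : ℝ :=
  -((s - 1) ^ 3 * (s + 1) * (s ^ 2 + 2 * s - 1) * (3 * s ^ 2 + 2 * s + 1)) / (8 * s ^ 5)

/-- `α(s) = (3s²+2s+1)/(4(s²+1))`. [this work] -/
def soloInformedN4alpha (s : ℝ) : ℝ := (3 * s ^ 2 + 2 * s + 1) / (4 * (s ^ 2 + 1))

/-- `β(s) = s²/(2(s²+1)(s²+2s−1))`. [this work] -/
def soloInformedN4beta (s : ℝ) : ℝ := s ^ 2 / (2 * (s ^ 2 + 1) * (s ^ 2 + 2 * s - 1))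

/-- **The norm identity** `(1+ct²)²Δ + t²(g₁+g₃t²)² = (1−nt²)⁴`. [this work] -/
theorem soloInformed_n4_norm {s : ℝ} (hs : s ≠ 0) (t : ℝ) :
    (1 + soloInformedN4c s * t ^ 2) ^ 2 * ((1 - t ^ 2) * (1 - soloInformedQ4m s * t ^ 2)) +
        (t * (soloInformedN4g₁ s + soloInformedN4g₃ s * t ^ 2)) ^ 2 =
      (1 - soloInformedN4n s * t ^ 2) ^ 4 := by
  unfold soloInformedN4c soloInformedQ4m soloInformedN4g₁ soloInformedN4g₃ soloInformedN4n
  field_simp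
  ring

/-- **The numerator identity** `2(CB′−C′B)Δ − CBΔ′ = (q₀+q₂t²)(1−nt²)³`. [this work] -/
theorem soloInformed_n4_num {s : ℝ} (hs : s ≠ 0) (t : ℝ) :
    2 * ((1 + soloInformedN4c s * t ^ 2) * (soloInformedN4g₁ s + 3 * soloInformedN4g₃ s * t ^ 2) -
          2 * soloInformedN4c s * t * (t * (soloInformedN4g₁ s + soloInformedN4g₃ s * t ^ 2))) *
        ((1 - t ^ 2) * (1 - soloInformedQ4m s * t ^ 2)) -
      (1 + soloInformedN4c s * t ^ 2) * (t * (soloInformedN4g₁ s + soloInformedN4g₃ s * t ^ 2)) *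
        (-(2 * t) * (1 - soloInformedQ4m s * t ^ 2) + (1 - t ^ 2) * (-(soloInformedQ4m s * (2 * t)))) =
    (soloInformedN4q₀ s + soloInformedN4q₂ s * t ^ 2) * (1 - soloInformedN4n s * t ^ 2) ^ 3 := by
  unfold soloInformedN4c soloInformedQ4m soloInformedN4g₁ soloInformedN4g₃ soloInformedN4n
    soloInformedN4q₀ soloInformedN4q₂
  field_simp
  ring

/-- `n(s) < 0` for `1 < s`. [this work] -/
theorem soloInformed_n4_n_neg {s : ℝ} (hs1 : 1 < s) : soloInformedN4n s < 0 := by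
  have h0 : 0 < s := by linarith
  have h1 : 0 < s - 1 := by linarith
  unfold soloInformedN4n
  rw [neg_div]
  exact neg_neg_of_pos (by positivity)

/-- `g₁ + g₃ = (s²+1)²(s²+2s−1)²/(16s⁶) > 0` and `g₃ ≤ 0` (`1 < s`). [this work] -/
theorem soloInformed_n4_g {s : ℝ} (hs1 : 1 < s) :
    0 < soloInformedN4g₁ s + soloInformedN4g₃ s ∧ soloInformedN4g₃ s ≤ 0 := by
  have h0 : 0 < s := by linarith
  have hw : 0 < s ^ 2 + 2 * s - 1 := by nlinarith
  have e : soloInformedN4g₁ s + soloInformedN4g₃ s =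
      (s ^ 2 + 1) ^ 2 * (s ^ 2 + 2 * s - 1) ^ 2 / (16 * s ^ 6) := by
    unfold soloInformedN4g₁ soloInformedN4g₃
    field_simp
    ring
  refine ⟨by rw [e]; positivity, ?_⟩
  unfold soloInformedN4g₃
  rw [neg_div]
  exact neg_nonpos.2 (by positivity)

/-- **The residue does not vanish**: `q₂ + nq₀ = −(s−1)³(s+1)(s²+1)(s²+2s−1)/(2s⁵) < 0`.
[this work] -/
theorem soloInformed_n4_res {s : ℝ} (hs1 : 1 < s) :
    soloInformedN4q₂ s + soloInformedN4n s * soloInformedN4q₀ s < 0 := by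
  have h0 : 0 < s := by linarith
  have h1 : 0 < s - 1 := by linarith
  have hw : 0 < s ^ 2 + 2 * s - 1 := by nlinarith
  have e : soloInformedN4q₂ s + soloInformedN4n s * soloInformedN4q₀ s =
      -((s - 1) ^ 3 * (s + 1) * (s ^ 2 + 1) * (s ^ 2 + 2 * s - 1) / (2 * s ^ 5)) := by
    unfold soloInformedN4q₂ soloInformedN4n soloInformedN4q₀
    field_simp
    ring
  rw [e]
  exact neg_neg_of_pos (by positivity)

/-- **The constants**: `q₂/(q₂+nq₀) = α(s)`, `n/(q₂+nq₀) = β(s)`. [this work] -/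
theorem soloInformed_n4_alpha_beta {s : ℝ} (hs1 : 1 < s) :
    soloInformedN4q₂ s / (soloInformedN4q₂ s + soloInformedN4n s * soloInformedN4q₀ s) =
        soloInformedN4alpha s ∧
      soloInformedN4n s / (soloInformedN4q₂ s + soloInformedN4n s * soloInformedN4q₀ s) =
        soloInformedN4beta s := by
  have h0 : s ≠ 0 := by positivity
  have h3 : s ^ 2 + 1 ≠ 0 := by positivity
  have hw : 0 < s ^ 2 + 2 * s - 1 := by nlinarith
  have hd := (soloInformed_n4_res hs1).ne
  constructor
  · rw [div_eq_iff hd]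
    unfold soloInformedN4q₂ soloInformedN4alpha soloInformedN4n soloInformedN4q₀
    field_simp
    ring
  · have hD : 2 * (s ^ 2 + 1) * (s ^ 2 + 2 * s - 1) ≠ 0 := by positivity
    unfold soloInformedN4beta
    rw [div_eq_div_iff hd hD]
    unfold soloInformedN4n soloInformedN4q₂ soloInformedN4q₀
    field_simp
    ring

/-- All the constants are algebraic for algebraic `s`. [folklore] -/
theorem soloInformed_n4_isAlgebraic {s : ℝ} (hsa : IsAlgebraic ℚ s) :
    IsAlgebraic ℚ (soloInformedN4n s) ∧
      IsAlgebraic ℚ (soloInformedN4c s) ∧ IsAlgebraic ℚ (soloInformedN4g₁ s) ∧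
      IsAlgebraic ℚ (soloInformedN4g₃ s) ∧ IsAlgebraic ℚ (soloInformedN4q₀ s) ∧
      IsAlgebraic ℚ (soloInformedN4q₂ s) ∧ IsAlgebraic ℚ (soloInformedN4alpha s) ∧
      IsAlgebraic ℚ (soloInformedN4beta s) := by
  have hs : s ∈ algebraicClosure ℚ ℝ := mem_algebraicClosure_iff.2 hsa
  have hN : ∀ k : ℕ, (k : ℝ) ∈ algebraicClosure ℚ ℝ := fun k => natCast_mem _ k
  have h2 : (2:ℝ) ∈ algebraicClosure ℚ ℝ := by exact_mod_cast hN 2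
  have h3 : (3:ℝ) ∈ algebraicClosure ℚ ℝ := by exact_mod_cast hN 3
  have h4 : (4:ℝ) ∈ algebraicClosure ℚ ℝ := by exact_mod_cast hN 4
  have h8 : (8:ℝ) ∈ algebraicClosure ℚ ℝ := by exact_mod_cast hN 8
  have h16 : (16:ℝ) ∈ algebraicClosure ℚ ℝ := by exact_mod_cast hN 16
  refine ⟨mem_algebraicClosure_iff.1 ?_, mem_algebraicClosure_iff.1 ?_, mem_algebraicClosure_iff.1 ?_,
    mem_algebraicClosure_iff.1 ?_, mem_algebraicClosure_iff.1 ?_, mem_algebraicClosure_iff.1 ?_,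
    mem_algebraicClosure_iff.1 ?_, mem_algebraicClosure_iff.1 ?_⟩
  · unfold soloInformedN4n; apply_rules (transparency := .reducible) (maxDepth := 250) only
      [pow_mem, div_mem, mul_mem, sub_mem, add_mem, one_mem, neg_mem, hs, h2, h3, h4]
  · unfold soloInformedN4c; apply_rules (transparency := .reducible) (maxDepth := 250) only
      [pow_mem, div_mem, mul_mem, sub_mem, add_mem, one_mem, neg_mem, hs, h2, h4]
  · unfold soloInformedN4g₁; apply_rules (transparency := .reducible) (maxDepth := 250) only
      [pow_mem, div_mem, mul_mem, sub_mem, add_mem, one_mem, hs, h2, h3, h4]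
  · unfold soloInformedN4g₃; apply_rules (transparency := .reducible) (maxDepth := 250) only
      [pow_mem, div_mem, mul_mem, sub_mem, add_mem, one_mem, neg_mem, hs, h2, h3, h4, h16]
  · unfold soloInformedN4q₀; apply_rules (transparency := .reducible) (maxDepth := 250) only
      [pow_mem, div_mem, mul_mem, sub_mem, add_mem, one_mem, hs, h2, h3, h4]
  · unfold soloInformedN4q₂; apply_rules (transparency := .reducible) (maxDepth := 250) only
      [pow_mem, div_mem, mul_mem, sub_mem, add_mem, one_mem, neg_mem, hs, h2, h3, h4, h8]
  · unfold soloInformedN4alpha; apply_rules (transparency := .reducible) (maxDepth := 250) only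
      [pow_mem, div_mem, mul_mem, sub_mem, add_mem, one_mem, hs, h2, h3, h4]
  · unfold soloInformedN4beta; apply_rules (transparency := .reducible) (maxDepth := 250) only
      [pow_mem, div_mem, mul_mem, sub_mem, add_mem, one_mem, hs, h2, h3, h4]

/-- **The fibre `s = 2`**: `n = −3/32`, `α = 17/20`, `β = 2/35` (`M = 81/256`). [this work] -/
theorem soloInformed_n4_two : soloInformedN4n 2 = -(3 / 32) ∧
    soloInformedN4alpha 2 = 17 / 20 ∧ soloInformedN4beta 2 = 2 / 35 := by
  refine ⟨?_, ?_, ?_⟩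
  · norm_num [soloInformedN4n]
  · norm_num [soloInformedN4alpha]
  · norm_num [soloInformedN4beta]

end Summit.KontsevichZagierPeriods.KontsevichZagierPeriods.Theorems

end
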